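import Summits.HubbardSuperconductivity.HubbardSuperconductivity.Theorems.BalabanIRBirComplexStableXYRStubLinearPartSector
import Summits.HubbardSuperconductivity.HubbardSuperconductivity.Theorems.BalabanIRBirComplexStableXYRStubThinFormPolar
import HarnessLib

/-!
# Crux `BirComplexStableXYR`, line `fat-gaussian-defect-calculus`: stub E1 `stub_constCochainPythagoras`

Registered stub (lead c8, wave 8, skeleton `Cruxes/BirComplexStableXYR/Lines/fat_gaussian_defect_calculus.lean`),
helper (`--supports`) for the crux `Summit.HubbardSuperconductivity.HubbardSuperconductivity.Theses.BalabanIR.BirComplexStableXYR`: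
**Pythagoras for constant cochains.**

**Statement.** On the engine's torus `Λ L M = (Fin 2 → ZMod L) × ZMod M` with the space–time chart
`F = TorusChart.piProdZMod 2 L M` (directions `0, 1` spatial, `2` temporal), let `P ω s w` be the window path
configuration of a real `1`-cochain `ω` (the staircase sum of `ω` from the corner `s`: `w.1` edges in direction `0`,
then `w.2.1` in direction `1`, then `w.2.2` in direction `2`; hypothesis `hP`) and let `Q u = Re(−Σ_n c_n (n·u)²)` be
the window Hessian form of the table `c` (hypothesis `hQ`).  Then for the CONSTANT cochain `x i ↦ v i` and any real
field `u` the thin form `𝒬(ω) = Σ_s Q (P ω s)` satisfies `𝒬(d₀u − v) = 𝒬(d₀u) + 𝒬(v)`.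

**Proof.** Everything is a finite sum.  (1) The staircase is additive in the cochain (`TorusChart.lineSum_sub`), so
`P (d₀u − v) s w = P (d₀u) s w − P v s w`; the staircase of the constant cochain does not depend on the corner `s`
(its summands do not mention the site), write it `b w`; and the staircase of a gradient telescopes,
`P (d₀u) s w = u (sh L M s w) − u s` (`TorusChart.lineSum_d₀`, landed `staircase_endpoint_eq_sh`), whence
`Σ_s P (d₀u) s w = 0` for every `w` (landed `linearPartSector_sum_sh`: `s ↦ sh L M s w` is a translation of the finite
torus).  (2) For real `u`, `Q u = Σ_{n ∈ supp c} Re(−c_n) (n·u)²` (landed `thinFormPolar_hessRe_eq`), so expanding the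
square, `Q (A_s − b) = Q (A_s) + Q b − Σ_n 2 Re(−c_n) (n·b) (n·A_s)`, and the cross term summed over `s` is
`Σ_n 2 Re(−c_n) (n·b) Σ_w n_w Σ_s A_s w = 0` (abstract finite-sum lemma `constPyth_core`).  Elementary; no definition
and no named fact is introduced; no hypothesis on the table is used; sorry-free. [folklore]
-/

set_option linter.dupNamespace false -- `Summit.<S>.<S>.Theorems…` repeats the summit name (D-0017 layout)

namespace Summit.HubbardSuperconductivity.HubbardSuperconductivity.Theorems.FSUnfolding

open scoped BigOperators
open Literature.MathematicalPhysics.QuantumFieldTheory Literature.Probability.LatticeModels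
open Summit.HubbardSuperconductivity.BirComplexStableXYNegative

/-- **Pythagoras for a signed sum of squares of linear functionals against translates summing to zero** (abstract
finite-sum core of `stub_constCochainPythagoras`).  If `Q a = Σ_{n ∈ cs} r_n (Σ_w ν_{n,w} a_w)²` and the family
`A : S → κ → ℝ` satisfies `Σ_s A s w = 0` for every `w`, then for every fixed `b : κ → ℝ`,
`Σ_s Q (A s − b) = Σ_s Q (A s) + Σ_s Q b`: the cross term `Σ_s Σ_n 2 r_n (ν_n·b)(ν_n·A s)` vanishes after exchanging
the sums. [folklore] -/
theorem constPyth_core {ι κ S : Type*} [Fintype κ] [Fintype S] (cs : Finset ι) (cre : ι → ℝ)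
    (nw : ι → κ → ℝ) (Q : (κ → ℝ) → ℝ)
    (hQ : ∀ a : κ → ℝ, Q a = ∑ n ∈ cs, cre n * (∑ w : κ, nw n w * a w) ^ 2)
    (A : S → κ → ℝ) (b : κ → ℝ) (hA : ∀ w : κ, ∑ s : S, A s w = 0) :
    ∑ s : S, Q (fun w => A s w - b w) = ∑ s : S, Q (A s) + ∑ _s : S, Q b := by
  -- expansion of the square, corner by corner
  have hexp : ∀ s : S, Q (fun w => A s w - b w)
      = Q (A s) + Q b - ∑ n ∈ cs, (2 * cre n * ∑ w : κ, nw n w * b w) * ∑ w : κ, nw n w * A s w := by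
    intro s
    have hin : ∀ n : ι, ∑ w : κ, nw n w * (A s w - b w)
        = (∑ w : κ, nw n w * A s w) - ∑ w : κ, nw n w * b w := by
      intro n
      rw [← Finset.sum_sub_distrib]
      exact Finset.sum_congr rfl fun w _ => mul_sub _ _ _
    simp only [hQ]
    rw [← Finset.sum_add_distrib, ← Finset.sum_sub_distrib]
    refine Finset.sum_congr rfl fun n _ => ?_
    rw [hin n]
    ring
  -- the cross term vanishes after summing over the corners
  have hcross : ∑ s : S, ∑ n ∈ cs, (2 * cre n * ∑ w : κ, nw n w * b w) * ∑ w : κ, nw n w * A s w = 0 := by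
    rw [Finset.sum_comm]
    refine Finset.sum_eq_zero fun n _ => ?_
    have h0 : ∑ s : S, ∑ w : κ, nw n w * A s w = 0 := by
      rw [Finset.sum_comm]
      exact Finset.sum_eq_zero fun w _ => by rw [← Finset.mul_sum, hA w, mul_zero]
    rw [← Finset.mul_sum, h0, mul_zero]
  rw [Finset.sum_congr rfl fun s _ => hexp s, Finset.sum_sub_distrib, Finset.sum_add_distrib, hcross, sub_zero]

/-- **Stub E1 `stub_constCochainPythagoras` (registered signature, verbatim): Pythagoras for constant cochains.**
For the constant real `1`-cochain `x i ↦ v i` and any real field `u` on the engine's torus, the thin Gaussian form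
`𝒬(ω) = Σ_s Q (P ω s)` of the window path configurations splits: `𝒬(d₀u − v) = 𝒬(d₀u) + 𝒬(v)`.  (The staircase is
additive in the cochain; the staircase of the constant cochain does not depend on the corner; the staircase of `d₀u`
telescopes to `u (sh L M s w) − u s`, whose corner sum vanishes by translation invariance; and `Q` is a real signed sum
of squares of the linear functionals `u ↦ n·u`, so the cross term is `Σ_n 2Re(−c_n)(n·b) Σ_w n_w Σ_s (u (sh s w) − u s)
= 0`.)  This is the equality case behind the holonomy-sector weights of chapter 2: with E2 the Gaussian weight of a
constant strain is `exp(−(K/2)|Λ|Q(v̄))`. [folklore] -/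
theorem stub_constCochainPythagoras :
    ∀ (r : ℕ) (c : Table r) (L M : ℕ) [NeZero L] [NeZero M]
      (P : (Λ L M → Fin 3 → ℝ) → Λ L M → W r → ℝ),
      (∀ (ω : Λ L M → Fin 3 → ℝ) (s : Λ L M) (w : W r), P ω s w =
        (TorusChart.piProdZMod 2 L M).lineSum ω 0 (w.1 : ℕ) s
          + (TorusChart.piProdZMod 2 L M).lineSum ω 1 (w.2.1 : ℕ) (s + (w.1 : ℕ) • (TorusChart.piProdZMod 2 L M).gen 0)
          + (TorusChart.piProdZMod 2 L M).lineSum ω 2 (w.2.2 : ℕ)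
            (s + (w.1 : ℕ) • (TorusChart.piProdZMod 2 L M).gen 0 + (w.2.1 : ℕ) • (TorusChart.piProdZMod 2 L M).gen 1)) →
      ∀ (Q : (W r → ℝ) → ℝ),
      (∀ u : W r → ℝ, Q u = (-c.sum (fun n a => a * (((∑ w, (n w : ℝ) * u w) ^ 2 : ℝ) : ℂ))).re) →
      ∀ (v : Fin 3 → ℝ) (u : Λ L M → ℝ),
        ∑ s : Λ L M, Q (P (fun x i => (TorusChart.piProdZMod 2 L M).d₀ u x i - v i) s) =
          ∑ s : Λ L M, Q (P ((TorusChart.piProdZMod 2 L M).d₀ u) s) + ∑ s : Λ L M, Q (P (fun _ i => v i) s) := by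
  intro r c L M _ _ P hP Q hQ v u
  -- (2) for real configurations the window Hessian form is a real signed sum of squares
  have hQre : ∀ a : W r → ℝ, Q a = ∑ n ∈ c.support, (-(c n)).re * (∑ w, (n w : ℝ) * a w) ^ 2 :=
    fun a => by rw [hQ, thinFormPolar_hessRe_eq]
  -- (1a) the staircase of the constant cochain does not depend on the corner
  obtain ⟨b, hb⟩ : ∃ b : W r → ℝ, ∀ (s : Λ L M) (w : W r), P (fun _ i => v i) s w = b w :=
    ⟨fun w => P (fun _ i => v i) 0 w, fun s w => by simp only [hP, TorusChart.lineSum]⟩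
  -- (1b) the staircase of a gradient telescopes, so its corner sum vanishes
  have hA : ∀ (s : Λ L M) (w : W r), P ((TorusChart.piProdZMod 2 L M).d₀ u) s w = u (sh L M s w) - u s := by
    intro s w
    rw [hP, TorusChart.lineSum_d₀, TorusChart.lineSum_d₀, TorusChart.lineSum_d₀, staircase_endpoint_eq_sh r L M s w]
    ring
  have hAsum : ∀ w : W r, ∑ s : Λ L M, P ((TorusChart.piProdZMod 2 L M).d₀ u) s w = 0 := by
    intro w
    simp only [hA]
    rw [Finset.sum_sub_distrib, linearPartSector_sum_sh r L M u w, sub_self]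
  -- (1c) additivity of the staircase in the cochain
  have hsub : ∀ s : Λ L M, P (fun x i => (TorusChart.piProdZMod 2 L M).d₀ u x i - v i) s =
      fun w => P ((TorusChart.piProdZMod 2 L M).d₀ u) s w - b w := by
    intro s
    funext w
    have h1 : (fun x i => (TorusChart.piProdZMod 2 L M).d₀ u x i - v i) =
        (TorusChart.piProdZMod 2 L M).d₀ u - fun (_ : Λ L M) (i : Fin 3) => v i := rfl
    rw [← hb s w, h1, hP, hP, hP, TorusChart.lineSum_sub, TorusChart.lineSum_sub, TorusChart.lineSum_sub]
    ring
  have hbfun : ∀ s : Λ L M, P (fun _ i => v i) s = b := fun s => funext fun w => hb s w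
  -- (3) assemble with the abstract finite-sum core
  simp only [hsub, hbfun]
  exact constPyth_core c.support (fun n => (-(c n)).re) (fun (n : W r → ℤ) (w : W r) => (n w : ℝ)) Q hQre
    (P ((TorusChart.piProdZMod 2 L M).d₀ u)) b hAsum

end Summit.HubbardSuperconductivity.HubbardSuperconductivity.Theorems.FSUnfolding
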